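import Summits.BirchSwinnertonDyer.Rank1Residual.GaloisImage.MazurTateNormRelation
import Mathlib.NumberTheory.DirichletCharacter.Basic
import HarnessLib

/-!
# Character components of the Mazur–Tate modular element at INDUCED (imprimitive) characters
# (cell `b2b-bsdres`, team n1011, ROUTE-1 PORT anatomy (P-KIM) = `cells/n1011/skel/T-PORT-1-PKIM.md`
# §3 item (K-ii), "the only non-mechanical part: the imprimitive characters mod `m`"; OWNERS row
# T-PKIM-K12, file F-C; seat p15 GEN 9)

HONEST FRAMING (cell `b2b-bsdres`, run/shared/lean/b2b/bsd-rank1-residual/, verbatim in every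
file): the goal of the cell is to DELETE the COMBINATION-SHAPED residual classes of the
Birch–Swinnerton-Dyer formula for ALL analytic-rank `≤ 1` elliptic curves over `ℚ` — "full BSD
formula for every rank `≤ 1` curve in class `C`" assembled STRICTLY from published theorems — so
that the rank-`≤ 1` remainder becomes exactly the CONSTRUCTION-SHAPED classes, which are TYPED
(missing-input `Prop`s), NOT attempted. This is not "finishing BSD". Team n1011 (N10/N11; ROUTE 1,
the PORT anatomy (P-KIM) of class X4 ∧ `p = 3`): research route on CONSTRUCTION-SHAPED classes;
prove what is provable now; no claim beyond stated classes; census output = EVIDENCE, never a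
Literature fact; RESIDUAL-MAP marks UNCHANGED; nothing is booked by this file. TOOL THEOREMS ONLY:
no definition, no named fact, no instance, no `sorry`.

## What

For a multiplicative character `φ : (ℤ/m)ˣ → A` (any commutative `ℚ`-algebra `A`) the
**`φ`-component** of a group-ring element `X = Σ_a X_a δ_a ∈ ℚ[(ℤ/m)ˣ]` is
`φ(X) = Σ_a X_a φ(a) = MonoidAlgebra.lift ℚ A (ℤ/m)ˣ φ X` (an ALGEBRA homomorphism — Mathlib).
For the Mazur–Tate modular element `θ̃_f(m) = Σ_a [a/m]⁺_f δ_a` (`modularElement f m`) this is the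
character sum `Σ_a [a/m]⁺_f φ(a)` (`lift_modularElement`). The norm relation of F-B
(`mapDomain_unitsMap_modularElement[_of_hecke]`: `π_* θ̃_f(mℓ) = (a_ℓ − σ_ℓ − σ_ℓ⁻¹)·θ̃_f(m)` for a
prime `ℓ ∤ m` with Hecke eigenvalue `a_ℓ`) and `lift ∘ mapDomain = lift ∘ comp`
(`lift_mapDomain`) give the **level-change law of the character components at characters of level
`mℓ` INDUCED from level `m`**:

* `lift_comp_unitsMap_modularElement_mul_of_hecke` / `…_modularElement_mul` —
  `(φ ∘ π)(θ̃_f(mℓ)) = (a_ℓ − φ(σ_ℓ) − φ(σ_ℓ⁻¹)) · φ(θ̃_f(m))`;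
* `sum_changeLevel_mul_ratPlusSymbol_of_hecke` / `sum_changeLevel_mul_ratPlusSymbol` — the same for a
  Dirichlet character `χ₀` mod `m` and its induced character `χ = changeLevel χ₀` mod `mℓ`:
  **`Σ_{b ∈ (ℤ/mℓ)ˣ} χ(b)·[b/(mℓ)]⁺_f = (a_ℓ − χ₀(ℓ) − χ₀⁻¹(ℓ)) · Σ_{a ∈ (ℤ/m)ˣ} χ₀(a)·[a/m]⁺_f`**
  (iterable prime by prime down to the conductor of `χ`).

This is the imprimitive-character half of item (K-ii) of the PORT anatomy: together with Birch's
formula for PRIMITIVE characters (the tree's `twisted_LValue_eq_holds`, NOT restated here) it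
expresses every character component of `θ̃_f(n)`, `n` squarefree, through twisted `L`-values and
the Euler-type factors `(a_ℓ − χ₀(ℓ) − χ₀⁻¹(ℓ))`, `ℓ ∣ n / cond(χ)`. HONEST LIMITS / NOT here: no
comparison with Kato's depletion factor `P_ℓ(ℓ⁻¹σ_ℓ⁻¹) = 1 − a_ℓℓ⁻¹σ_ℓ⁻¹ + ℓ⁻¹σ_ℓ⁻²` (which differs
from `−ℓ⁻¹σ_ℓ⁻¹·(a_ℓ − ℓσ_ℓ − σ_ℓ⁻¹)`'s companion `(a_ℓ − σ_ℓ − σ_ℓ⁻¹)` by the classical `ℓ ≡ 1`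
discrepancy — PK-6's bookkeeping on r1's binder sheet), no `ZetaBody`, no Euler system, no Gauss
sum, no Kolyvagin statement; closes nothing; books nothing.

References: K. Ota, Amer. J. Math. 140 (2018) Prop. 2.3 (1) [Ota2018]; B. Mazur, J. Tate, Duke
Math. J. 54 (1987) §1; M. Kurihara, arXiv:1407.2465 §1.1 [Kurihara2014]; B. Mazur, J. Tate,
J. Teitelbaum, Invent. Math. 84 (1986) §I.4 (4.2), §I.8 [MazurTateTeitelbaum1986Invent].
-/

noncomputable section

open scoped BigOperators

namespace Summit.BirchSwinnertonDyer.Rank1Residual.GaloisImage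

namespace CharComponent

open Literature.NumberTheory.EllipticCurves Literature.NumberTheory.EllipticCurves.ModularForms
open CongruenceSubgroup

/-! ### §1 Character components of group-ring elements (generic) -/

section Generic

variable {R : Type*} [CommSemiring R] {A : Type*} [Semiring A] [Algebra R A]
variable {M N : Type*} [Monoid M] [Monoid N]

/-- `φ(π_* X) = (φ ∘ π)(X)`: evaluating a pushed-forward group-ring element at a character is
evaluating the element at the pulled-back character. [folklore] -/
theorem lift_mapDomain (φ : N →* A) (π : M →* N) (X : MonoidAlgebra R M) :
    MonoidAlgebra.lift R A N φ (MonoidAlgebra.mapDomain π X) =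
      MonoidAlgebra.lift R A M (φ.comp π) X := by
  induction X using MonoidAlgebra.induction_linear with
  | zero => simp
  | add x y hx hy => rw [MonoidAlgebra.mapDomain_add, map_add, map_add, hx, hy]
  | single a r =>
    rw [MonoidAlgebra.mapDomain_single, MonoidAlgebra.lift_single, MonoidAlgebra.lift_single,
      MonoidHom.comp_apply]

end Generic

section GenericRing

variable {R : Type*} [CommRing R] {A : Type*} [Ring A] [Algebra R A]

/-- `φ(r·δ_1 − δ_g − δ_{g⁻¹}) = r − φ(g) − φ(g⁻¹)`. [folklore] -/
theorem lift_single_one_sub_single_sub_single {G : Type*} [Group G] (φ : G →* A) (r : R) (g : G) :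
    MonoidAlgebra.lift R A G φ
        (MonoidAlgebra.single 1 r - MonoidAlgebra.single g 1 - MonoidAlgebra.single g⁻¹ 1) =
      algebraMap R A r - φ g - φ g⁻¹ := by
  rw [map_sub, map_sub, MonoidAlgebra.lift_single, MonoidAlgebra.lift_single,
    MonoidAlgebra.lift_single, map_one, Algebra.smul_def, mul_one, one_smul, one_smul]

end GenericRing

/-! ### §2 Character components of the modular element and their level-change law -/

section ModularElement

variable {A : Type*} [CommRing A] [Algebra ℚ A]
variable {N : ℕ} (f : CuspForm (Gamma0 N) 2) {m ℓ : ℕ} [NeZero m] [NeZero ℓ]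

omit [NeZero ℓ] in
/-- The `φ`-component of the modular element is the character sum
`φ(θ̃_f(m)) = Σ_{a ∈ (ℤ/m)ˣ} [a/m]⁺_f · φ(a)`. [cite: Kurihara2014, §1.1 (1) (PDF p. 2)] -/
theorem lift_modularElement (φ : (ZMod m)ˣ →* A) :
    MonoidAlgebra.lift ℚ A (ZMod m)ˣ φ (modularElement f m) =
      ∑ a : (ZMod m)ˣ, algebraMap ℚ A (ratPlusSymbol f (((a : ZMod m).val : ℚ) / m)) * φ a := by
  rw [modularElement, map_sum]
  refine Finset.sum_congr rfl fun a _ => ?_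
  rw [MonoidAlgebra.lift_single, Algebra.smul_def]

/-- **Level-change law of the character components, Hecke-hypothesis form.** For a prime `ℓ` with
`gcd(ℓ, m) = 1`, a character `φ : (ℤ/m)ˣ → A` and the Hecke relation at `ℓ` with eigenvalue `a_ℓ`
(`hHecke`, as in F-B): `(φ ∘ π)(θ̃_f(mℓ)) = (a_ℓ − φ(σ_ℓ) − φ(σ_ℓ⁻¹)) · φ(θ̃_f(m))`, `σ_ℓ` the class
of `ℓ` in `(ℤ/m)ˣ` — the norm relation `mapDomain_unitsMap_modularElement_of_hecke` evaluated at `φ`.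
[cite: Ota2018, Prop. 2.3 (1)] -/
theorem lift_comp_unitsMap_modularElement_mul_of_hecke [NeZero N] (hℓ : ℓ.Prime)
    (hℓm : ℓ.Coprime m) {aℓ : ℤ}
    (hHecke : ∀ r : ℚ, (aℓ : ℚ) * ratPlusSymbol f r =
      ∑ j : Fin ℓ, ratPlusSymbol f ((r + j) / ℓ) + ratPlusSymbol f (ℓ * r))
    (φ : (ZMod m)ˣ →* A) :
    MonoidAlgebra.lift ℚ A (ZMod (m * ℓ))ˣ (φ.comp (ZMod.unitsMap (dvd_mul_right m ℓ)))
        (modularElement f (m * ℓ)) =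
      (algebraMap ℚ A aℓ - φ (ZMod.unitOfCoprime ℓ hℓm) - φ (ZMod.unitOfCoprime ℓ hℓm)⁻¹) *
        MonoidAlgebra.lift ℚ A (ZMod m)ˣ φ (modularElement f m) := by
  rw [← lift_mapDomain, mapDomain_unitsMap_modularElement_of_hecke f hℓ hℓm hHecke, map_mul,
    lift_single_one_sub_single_sub_single, map_intCast]

/-- **Level-change law of the character components** for a normalised newform `f ∈ S₂(Γ₀(N))` with
rational Fourier coefficients, a prime `ℓ ∤ N` with `gcd(ℓ, m) = 1` and `a_ℓ(f) = a_ℓ ∈ ℤ`: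
`(φ ∘ π)(θ̃_f(mℓ)) = (a_ℓ − φ(σ_ℓ) − φ(σ_ℓ⁻¹)) · φ(θ̃_f(m))` (the Hecke relation supplied by the
tree's `intCast_mul_ratPlusSymbol` / `ratCast_ratPlusSymbol_holds` through F-B's
`mapDomain_unitsMap_modularElement`). [cite: Ota2018, Prop. 2.3 (1)] -/
theorem lift_comp_unitsMap_modularElement_mul [NeZero N] (hf : IsNewform0 f)
    (hQ : coeffField f = ⊥) (hℓ : ℓ.Prime) (hℓN : ¬ ℓ ∣ N) (hℓm : ℓ.Coprime m) {aℓ : ℤ}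
    (haℓ : cuspCoeff f ℓ = aℓ) (φ : (ZMod m)ˣ →* A) :
    MonoidAlgebra.lift ℚ A (ZMod (m * ℓ))ˣ (φ.comp (ZMod.unitsMap (dvd_mul_right m ℓ)))
        (modularElement f (m * ℓ)) =
      (algebraMap ℚ A aℓ - φ (ZMod.unitOfCoprime ℓ hℓm) - φ (ZMod.unitOfCoprime ℓ hℓm)⁻¹) *
        MonoidAlgebra.lift ℚ A (ZMod m)ˣ φ (modularElement f m) :=
  lift_comp_unitsMap_modularElement_mul_of_hecke f hℓ hℓm
    (fun r => intCast_mul_ratPlusSymbol ℓ hf hℓ hℓN haℓ (ratCast_ratPlusSymbol_holds hf hQ) r) φ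

/-! ### §3 Dirichlet-character form: induced characters `changeLevel χ₀` -/

omit [Algebra ℚ A] [NeZero m] [NeZero ℓ] in
/-- The unit-group character of a Dirichlet character, with values in `A` (coercion of
`χ₀.toUnitHom`), agrees with `χ₀` on units. [folklore] -/
theorem coeHom_comp_toUnitHom_apply (χ₀ : DirichletCharacter A m) (a : (ZMod m)ˣ) :
    ((Units.coeHom A).comp χ₀.toUnitHom) a = χ₀ (a : ZMod m) := by
  rw [MonoidHom.comp_apply, Units.coeHom_apply, MulChar.coe_toUnitHom]

omit [Algebra ℚ A] [NeZero m] [NeZero ℓ] in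
/-- The induced character `χ = changeLevel χ₀` (level `m ∣ n`) on units of `ℤ/n` is `χ₀ ∘ π`:
as unit-group characters with values in `A`. [folklore] -/
theorem coeHom_comp_toUnitHom_changeLevel {n : ℕ} (h : m ∣ n) (χ₀ : DirichletCharacter A m) :
    (Units.coeHom A).comp (DirichletCharacter.changeLevel h χ₀).toUnitHom =
      ((Units.coeHom A).comp χ₀.toUnitHom).comp (ZMod.unitsMap h) := by
  rw [DirichletCharacter.changeLevel_toUnitHom, MonoidHom.comp_assoc]

omit [NeZero ℓ] in
/-- The character sum of `θ̃_f(m)` against a Dirichlet character `χ₀` mod `m` is its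
`χ₀`-component: `Σ_a [a/m]⁺_f χ₀(a) = χ₀(θ̃_f(m))`. [cite: Kurihara2014, §1.1 (1) (PDF p. 2)] -/
theorem sum_ratPlusSymbol_mul_eq_lift (χ₀ : DirichletCharacter A m) :
    ∑ a : (ZMod m)ˣ, algebraMap ℚ A (ratPlusSymbol f (((a : ZMod m).val : ℚ) / m)) * χ₀ (a : ZMod m) =
      MonoidAlgebra.lift ℚ A (ZMod m)ˣ ((Units.coeHom A).comp χ₀.toUnitHom) (modularElement f m) := by
  rw [lift_modularElement]
  refine Finset.sum_congr rfl fun a _ => ?_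
  rw [coeHom_comp_toUnitHom_apply]

omit [Algebra ℚ A] [NeZero m] [NeZero ℓ] in
/-- `χ₀` at the inverse class: `χ₀(σ⁻¹) = χ₀⁻¹(σ)` for a unit `σ`. [folklore] -/
theorem apply_coe_inv_eq_inv_apply (χ₀ : DirichletCharacter A m) (σ : (ZMod m)ˣ) :
    χ₀ ((σ⁻¹ : (ZMod m)ˣ) : ZMod m) = χ₀⁻¹ (σ : ZMod m) := by
  rw [MulChar.inv_apply, Ring.inverse_unit]

/-- **Character sums of the modular element at an INDUCED character, Hecke-hypothesis form**:
for a Dirichlet character `χ₀` mod `m`, a prime `ℓ` with `gcd(ℓ, m) = 1`, the induced character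
`χ = changeLevel χ₀` mod `mℓ`, and the Hecke relation at `ℓ` with eigenvalue `a_ℓ`:
`Σ_{b ∈ (ℤ/mℓ)ˣ} [b/(mℓ)]⁺_f χ(b) = (a_ℓ − χ₀(ℓ) − χ₀⁻¹(ℓ)) · Σ_{a ∈ (ℤ/m)ˣ} [a/m]⁺_f χ₀(a)`.
[cite: Ota2018, Prop. 2.3 (1)] -/
theorem sum_changeLevel_mul_ratPlusSymbol_of_hecke [NeZero N] (hℓ : ℓ.Prime) (hℓm : ℓ.Coprime m)
    {aℓ : ℤ}
    (hHecke : ∀ r : ℚ, (aℓ : ℚ) * ratPlusSymbol f r =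
      ∑ j : Fin ℓ, ratPlusSymbol f ((r + j) / ℓ) + ratPlusSymbol f (ℓ * r))
    (χ₀ : DirichletCharacter A m) :
    ∑ b : (ZMod (m * ℓ))ˣ,
        algebraMap ℚ A (ratPlusSymbol f (((b : ZMod (m * ℓ)).val : ℚ) / (m * ℓ : ℕ))) *
          DirichletCharacter.changeLevel (dvd_mul_right m ℓ) χ₀ (b : ZMod (m * ℓ)) =
      (algebraMap ℚ A aℓ - χ₀ (ℓ : ZMod m) - χ₀⁻¹ (ℓ : ZMod m)) *
        ∑ a : (ZMod m)ˣ, algebraMap ℚ A (ratPlusSymbol f (((a : ZMod m).val : ℚ) / m)) *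
          χ₀ (a : ZMod m) := by
  haveI : NeZero (m * ℓ) := ⟨mul_ne_zero (NeZero.ne m) (NeZero.ne ℓ)⟩
  rw [sum_ratPlusSymbol_mul_eq_lift, sum_ratPlusSymbol_mul_eq_lift f χ₀,
    coeHom_comp_toUnitHom_changeLevel,
    lift_comp_unitsMap_modularElement_mul_of_hecke f hℓ hℓm hHecke, coeHom_comp_toUnitHom_apply,
    coeHom_comp_toUnitHom_apply, ZMod.coe_unitOfCoprime, apply_coe_inv_eq_inv_apply,
    ZMod.coe_unitOfCoprime]

/-- **Character sums of the modular element at an INDUCED character** for a normalised newform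
`f ∈ S₂(Γ₀(N))` with rational Fourier coefficients, a prime `ℓ ∤ N`, `gcd(ℓ, m) = 1`,
`a_ℓ(f) = a_ℓ ∈ ℤ`, and a Dirichlet character `χ₀` mod `m` with induced character
`χ = changeLevel χ₀` mod `mℓ`:
`Σ_{b ∈ (ℤ/mℓ)ˣ} [b/(mℓ)]⁺_f χ(b) = (a_ℓ − χ₀(ℓ) − χ₀⁻¹(ℓ)) · Σ_{a ∈ (ℤ/m)ˣ} [a/m]⁺_f χ₀(a)` —
the imprimitive-character half of the PORT item (K-ii); the primitive half is Birch's formula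
(`twisted_LValue_eq_holds`, not restated). [cite: Ota2018, Prop. 2.3 (1)] -/
theorem sum_changeLevel_mul_ratPlusSymbol [NeZero N] (hf : IsNewform0 f) (hQ : coeffField f = ⊥)
    (hℓ : ℓ.Prime) (hℓN : ¬ ℓ ∣ N) (hℓm : ℓ.Coprime m) {aℓ : ℤ} (haℓ : cuspCoeff f ℓ = aℓ)
    (χ₀ : DirichletCharacter A m) :
    ∑ b : (ZMod (m * ℓ))ˣ,
        algebraMap ℚ A (ratPlusSymbol f (((b : ZMod (m * ℓ)).val : ℚ) / (m * ℓ : ℕ))) *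
          DirichletCharacter.changeLevel (dvd_mul_right m ℓ) χ₀ (b : ZMod (m * ℓ)) =
      (algebraMap ℚ A aℓ - χ₀ (ℓ : ZMod m) - χ₀⁻¹ (ℓ : ZMod m)) *
        ∑ a : (ZMod m)ˣ, algebraMap ℚ A (ratPlusSymbol f (((a : ZMod m).val : ℚ) / m)) *
          χ₀ (a : ZMod m) :=
  sum_changeLevel_mul_ratPlusSymbol_of_hecke f hℓ hℓm
    (fun r => intCast_mul_ratPlusSymbol ℓ hf hℓ hℓN haℓ (ratCast_ratPlusSymbol_holds hf hQ) r) χ₀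

end ModularElement

end CharComponent

end Summit.BirchSwinnertonDyer.Rank1Residual.GaloisImage

end
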